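import Summits.QuantumFields.BalabanUV.Beta.GAN24.DiagramDecayWindow
import Summits.QuantumFields.BalabanUV.T4Continuum.Support.BalabanAveragedTowerModes
import Summits.QuantumFields.BalabanUV.T4Continuum.Support.VariationalOpNorm
import Literature.MathematicalPhysics.QuantumFieldTheory.Balaban1983to89.Beta.VectorPropagatorLimit

/-!
# `BalabanUV.Beta.GAN24.VolumeLimitCovariance` — binder row G-an2-4 ∕ (CONV-C), route R7 «TWO CURRENCIES», PART 138: THE INSTANCE.  The four inputs (α) (β) (γ) + shift invariance of
# PART 137's `exists_isInfiniteVolumeLimit_inv_sub_re`, VERIFIED for the (1.18)-averaged unit-lattice free covariance `c_k = unitCovB k = (L^d)^k·Q_k𝒢^{(k)}Q_kᴴ` on the cubic tori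
# `(ℤ∕s)^d`: (α) volume-uniform window decay of `c_k((w,μ),(0,ν))`, (β) convergence of every entry `c_k((ẑ,μ),(0,ν))`, `z ∈ ℤ^d`, along the even cubic volumes `s = 2(t+1)` (`d ≥ 3`),
# (γ) `‖1 − Cst⁻¹•c_k‖ ≤ 1 − γ_B∕Cst < 1`, and `c_k((x+v,μ),(y+v,ν)) = c_k((x,μ),(y,ν))` — every constant free of the level `k` and of the volume.  PART 139 feeds them to PART 137 and
# discharges the one displayed hypothesis `IsInfiniteVolumeLimit` of PART 134's END theorem (unit b2b-balaban-gan24-p3, gen 54; v1)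

NOT IN PRINT; OUR PROOF ([folklore] bookkeeping BY NAME).  (β) is the β-cell's `Beta.VectorPropagatorLimit.calG_tendsto_Kinf` (row an5: `n²·𝒢_T((x̄,μ),(x̄′,ν)) → K^∞` along
`cubic d (2(t+1))`, `d ≥ 3`) applied to the ENTRY FORMULA §2: `c_k((y,μ),(y′,ν)) = (L^d)^k n^{−2(d+1)} Σ_{j,t,j′,t′} 𝒢^{(k)}((n·y + j + t e_μ, μ), (n·y′ + j′ + t′e_ν, ν))`, `n = L^k` — a FIXED
finite combination of fine-propagator entries at integer offsets (NE2's `Atow_QBlev_eq_submatrix`: the composite averaging IS the printed `Q_k = B5Block118.QvOp (L^k) M`, and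
`QvOp_mulVec`); shift invariance §3 is the β-cell's `VectorTailsPt.calG_translate` (block translations) + `bpt (y+v) j = bpt y j + up v`; (γ) §4 is `isHermitian_unitCovB` (PART 128) +
`uniformCoercive_unitCovB` (NE2, `γ_B`) + `opNorm_unitCovB_le` (NE2, `Cst`) through the generic §1 `opNorm_one_sub_smul_le` (a Hermitian `γ`-coercive `A` with `‖A‖ ≤ Λ` has
`‖1 − Λ⁻¹A‖ ≤ 1 − γ∕Λ`, over NE2's `VariationalOpNorm.opNorm_le_of_quadForm`); (α) §4 is PART 126's `hdec_unitCovB_of_wCoercive` at an admissible rate (`exists_admissible_rate`,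
`conjDefect_calDalev_rho`, `wCoercive_calDa_of_conjDefect` — the same six lines as PART 128) read through PART 134's `exp_distK_le_exp_window`.
[Balaban1984PropagatorsI] (1.18) p. 20, (1.83) p. 31 and [Balaban1987RG1] p. 264 (after (1.21): «Now we take a limit of these functions as T^{(j+1)} ↗ Z^d») LOCATE the objects and
the limit; nothing printed is a hypothesis.
HONEST FRAMING (cell contract, verbatim): «discharging `BetaPertH` makes Bałaban's UV stability UNCONDITIONAL — a real constructive-QFT result; it is NOT the
continuum limit and NOT the Clay problem.»  HONEST DEPENDENCY (verbatim): «continuum YM on T⁴ ⇐ BetaPertH ∧ nine spine estimates (0/9 proved); BetaPertH ⇐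
(D1) ∧ (D4) ∧ CAP+tail; G-an2-4 gates asym, D1 and NE2/3/4.»

WHAT THIS FILE PROVES (0 sorry, 0 `def`; `c_k` is read on `Tor M × Fin d` as `Matrix.reindex (unitIdx L M) (unitIdx L M) (unitCovB L M a ha k)`, entries `c_k(e(y,μ), e(y′,ν))`, `e = unitIdx⁻¹`):
* §1 (generic) `re_star_dotProduct_self`, `re_star_dotProduct_mulVec_le`, `le_opNorm_of_coercive`, **`opNorm_one_sub_smul_le`**, `one_sub_smul_reindex`, `reindex_inv_sub_smul_one_apply`.
* §2 `reindex_unitCovB_eq` (`= (L^d)^k•(Q_k𝒢^{(k)}Q_kᴴ)`), `star_QvOp`, `sum_QvOp_mul(_pair)`, `QGQ_apply(_pair)` (any fine kernel), **`reindex_unitCovB_apply`** (the entry formula).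
* §3 `up_castT_mul`, `up_mem_blockSteps`, `bpt_add_left`, **`reindex_unitCovB_shift`**.
* §4 **`opNorm_one_sub_smul_unitCovB_le`** (γ, `d ≥ 1`), `one_sub_gammaB_div_Cst_lt_one`, **`exists_windowDecay_unitCovB`** (α: `∃ κ > 0, B ≥ 0` from `(d, a)`: `‖c_k(e(w,μ),e(0,ν))‖ ≤ B·e^{−(κ∕d)|windowMap w|₁}`
  for every cubic torus, level, `μ, ν, w`).
* §5 `up_zero`, `bpt_castT_add_tstep`, `bpt_zero_add_tstep`, **`tendsto_reindex_unitCovB`** (β, `d ≥ 3`: `∃ c, c_k(e(ẑ_t,μ), e(0,ν)) → c` along `cubic d (evenPeriod t)`, every `z ∈ ℤ^d`).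
WHAT IT DOES NOT DO: identify the limit (it is explicit in an5's `K^∞`, not needed); odd or non-cubic volumes (an5's limit theorem is stated along `2(t+1)`); `d ≤ 2`; `U ≠ 1`.  SUPPLIER work;
no consumer of record beyond PART 139; NEVER «G-an2-4 closed»; NOT (CONV-C), NOT D1, NOT `BetaPertH`, NOT continuum, NOT Clay.  Records: `HOME/b2b-balaban-gan24-p3/gen54/README.md`.
-/

noncomputable section

open scoped BigOperators ComplexConjugate Matrix Matrix.Norms.L2Operator
open Filter Topology

namespace Summit.QuantumFields.BalabanUV.Beta.GAN24.VolumeLimitCovariance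

open Literature.MathematicalPhysics.QuantumFieldTheory.Balaban1983to89
open Literature.MathematicalPhysics.QuantumFieldTheory.Balaban1983to89.B5Prop11Plancherel (Tor fine calG opNorm_reindex Cst Cst_nonneg)
open Literature.MathematicalPhysics.QuantumFieldTheory.Balaban1983to89.B5Prop11Lower (nsq nsq_nonneg nsq_mulVec_le norm_star_dotProduct_le)
open Literature.MathematicalPhysics.QuantumFieldTheory.Balaban1983to89.B5Block118 (QvOp bpt tstep up iota lineSum QvOp_mulVec up_add upHom_intCast)
open Literature.MathematicalPhysics.QuantumFieldTheory.Balaban1983to89.B5G183RateUnitTower (lev)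
open Literature.MathematicalPhysics.QuantumFieldTheory.Balaban1983to89.Beta.VectorTails (castT liftZ castT_liftZ)
open Literature.MathematicalPhysics.QuantumFieldTheory.Balaban1983to89.Beta.VectorTailsPt (blockSteps calG_translate castT_blockVec_mem_blockSteps)
open Summit.QuantumFields.BalabanUV.T4Continuum
open Summit.QuantumFields.BalabanUV.T4Continuum.CoerciveInverseTower (Coercive)
open Summit.QuantumFields.BalabanUV.T4Continuum.CovariantAveragingTower (Atow avgTow)
open Summit.QuantumFields.BalabanUV.T4Continuum.BalabanAveragedTowerUnit (idx QBlev calGlev unitCovB one_le_lev' cast_lev')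
open Summit.QuantumFields.BalabanUV.T4Continuum.BalabanAveragedCoerciveTower (unitIdx unitIdx_apply Atow_QBlev_eq_submatrix uniformCoercive_unitCovB)
open Literature.MathematicalPhysics.QuantumFieldTheory.Balaban1983to89.B12Sec2to5 (l1)
open Literature.MathematicalPhysics.QuantumFieldTheory.Balaban1983to89.Beta (Site windowMap)
open Literature.MathematicalPhysics.QuantumFieldTheory.Balaban1983to89.Beta.FreeLegDictionary (cubic)
open Literature.MathematicalPhysics.QuantumFieldTheory.Balaban1983to89.Beta.BlockKernelVolumeSockets (evenPeriod tendsto_evenPeriod)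
open Literature.MathematicalPhysics.QuantumFieldTheory.Balaban1983to89.Beta.VectorPropagatorLimit (Kinf calG_tendsto_Kinf)
open Summit.QuantumFields.BalabanUV.T4Continuum.BalabanAveragedCoercive (gammaB gammaB_pos)
open Summit.QuantumFields.BalabanUV.T4Continuum.BalabanAveragedTowerModes (opNorm_unitCovB_le)
open Summit.QuantumFields.BalabanUV.T4Continuum.VariationalOpNorm (opNorm_le_of_quadForm)
open Summit.QuantumFields.BalabanUV.T4Continuum.KingPairingPlantedLaw (calDalev)
open Summit.QuantumFields.BalabanUV.T4Continuum.CTWeightedCoercivity (WCoercive)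
open Summit.QuantumFields.BalabanUV.T4Continuum.CTKingTowerWeights (rho distK)
open Summit.QuantumFields.BalabanUV.T4Continuum.CTConjugatedHbd (wCoercive_calDa_of_conjDefect)
open Summit.QuantumFields.BalabanUV.T4Continuum.CTConjDefectDischarge (conjDefect_calDalev_rho max_JA_lt_gamD)
open Summit.QuantumFields.BalabanUV.T4Continuum.DirichletRegionTower (gamD)
open Summit.QuantumFields.BalabanUV.T4Continuum.CTVectorPropagator (JA)
open Summit.QuantumFields.BalabanUV.T4Continuum.DecayRateInterpolation (EntryDecay)
open Summit.QuantumFields.BalabanUV.Beta.GAN24.InsertionChainDecay (exists_admissible_rate)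
open Summit.QuantumFields.BalabanUV.Beta.GAN24.InsertionChainDecayBalaban (hdec_unitCovB_of_wCoercive)
open Summit.QuantumFields.BalabanUV.Beta.GAN24.EffectiveFormDecay (isHermitian_unitCovB)
open Summit.QuantumFields.BalabanUV.Beta.GAN24.DiagramDecayWindow (exp_distK_le_exp_window)

/-! ## §1 Hermitian sandwich ⟹ `‖1 − Λ⁻¹A‖ ≤ 1 − γ∕Λ` -/

section Generic

variable {ι : Type*} [Fintype ι] [DecidableEq ι]

omit [DecidableEq ι] in
/-- `Re⟨v, v⟩ = Σ|v_i|²`. [folklore] -/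
theorem re_star_dotProduct_self (v : ι → ℂ) : (star v ⬝ᵥ v).re = nsq v := by
  simp only [dotProduct, Pi.star_apply, Complex.re_sum, nsq]
  refine Finset.sum_congr rfl fun i _ => ?_
  rw [Complex.star_def, Complex.conj_mul', ← Complex.ofReal_pow, Complex.ofReal_re]

/-- `Re⟨v, Av⟩ ≤ ‖A‖·Σ|v_i|²`. [folklore] -/
theorem re_star_dotProduct_mulVec_le (A : Matrix ι ι ℂ) (v : ι → ℂ) : (star v ⬝ᵥ (A *ᵥ v)).re ≤ ‖A‖ * nsq v := by
  have h1 : (star v ⬝ᵥ (A *ᵥ v)).re ≤ Real.sqrt (nsq v) * Real.sqrt (nsq (A *ᵥ v)) :=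
    (Complex.re_le_norm _).trans (norm_star_dotProduct_le v (A *ᵥ v))
  have h2 : Real.sqrt (nsq (A *ᵥ v)) ≤ ‖A‖ * Real.sqrt (nsq v) := by
    rw [← Real.sqrt_sq (norm_nonneg A), ← Real.sqrt_mul (sq_nonneg _)]
    exact Real.sqrt_le_sqrt (nsq_mulVec_le A v)
  calc (star v ⬝ᵥ (A *ᵥ v)).re ≤ Real.sqrt (nsq v) * (‖A‖ * Real.sqrt (nsq v)) :=
        h1.trans (mul_le_mul_of_nonneg_left h2 (Real.sqrt_nonneg _))
    _ = ‖A‖ * nsq v := by rw [mul_left_comm, Real.mul_self_sqrt (nsq_nonneg v)]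

/-- a coercivity constant is at most the operator norm (nonempty index). [folklore] -/
theorem le_opNorm_of_coercive [Nonempty ι] {γ : ℝ} {A : Matrix ι ι ℂ} (hco : Coercive γ A) : γ ≤ ‖A‖ := by
  classical
  obtain ⟨i⟩ := ‹Nonempty ι›
  have hv : nsq (Pi.single i (1 : ℂ)) = 1 := by
    simp only [nsq, Pi.single_apply, apply_ite norm, norm_one, norm_zero]
    simp [Finset.sum_ite_eq']
  have h := (hco (Pi.single i 1)).trans (re_star_dotProduct_mulVec_le A (Pi.single i 1))
  rwa [hv, mul_one, mul_one] at h

/-- **`opNorm_one_sub_smul_le` — HERMITIAN SANDWICH ⟹ NEUMANN RATIO** [folklore]: a Hermitian `γ`-coercive matrix with `‖A‖ ≤ Λ` (`0 < γ ≤ Λ`) has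
`‖1 − Λ⁻¹•A‖ ≤ 1 − γ∕Λ` (its form lies in `[0, (1 − γ∕Λ)‖v‖²]`). -/
theorem opNorm_one_sub_smul_le {A : Matrix ι ι ℂ} (hA : A.IsHermitian) {γ Λ : ℝ} (hγ : 0 < γ) (hγΛ : γ ≤ Λ) (hco : Coercive γ A) (hΛ : ‖A‖ ≤ Λ) :
    ‖(1 : Matrix ι ι ℂ) - ((Λ⁻¹ : ℝ) : ℂ) • A‖ ≤ 1 - γ / Λ := by
  have hΛ0 : 0 < Λ := lt_of_lt_of_le hγ hγΛ
  have hM : 0 ≤ 1 - γ / Λ := sub_nonneg.mpr ((div_le_one hΛ0).mpr hγΛ)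
  have hX : ((1 : Matrix ι ι ℂ) - ((Λ⁻¹ : ℝ) : ℂ) • A).IsHermitian := by
    unfold Matrix.IsHermitian
    rw [Matrix.conjTranspose_sub, Matrix.conjTranspose_one, Matrix.conjTranspose_smul, hA.eq, Complex.star_def, Complex.conj_ofReal]
  refine opNorm_le_of_quadForm hX hM fun v => ?_
  have hform : (star v ⬝ᵥ (((1 : Matrix ι ι ℂ) - ((Λ⁻¹ : ℝ) : ℂ) • A) *ᵥ v)).re = nsq v - Λ⁻¹ * (star v ⬝ᵥ (A *ᵥ v)).re := by
    rw [Matrix.sub_mulVec, Matrix.one_mulVec, Matrix.smul_mulVec, dotProduct_sub, dotProduct_smul, Complex.sub_re, smul_eq_mul,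
      Complex.re_ofReal_mul, re_star_dotProduct_self]
  rw [hform, show ∑ i, ‖v i‖ ^ 2 = nsq v from rfl]
  have hlo : γ * nsq v ≤ (star v ⬝ᵥ (A *ᵥ v)).re := hco v
  have hhi : (star v ⬝ᵥ (A *ᵥ v)).re ≤ Λ * nsq v := (re_star_dotProduct_mulVec_le A v).trans (mul_le_mul_of_nonneg_right hΛ (nsq_nonneg v))
  have hn := nsq_nonneg v
  have hΛi : 0 < Λ⁻¹ := inv_pos.mpr hΛ0
  rw [abs_le]
  constructor
  · have : Λ⁻¹ * (star v ⬝ᵥ (A *ᵥ v)).re ≤ Λ⁻¹ * (Λ * nsq v) := mul_le_mul_of_nonneg_left hhi hΛi.le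
    rw [← mul_assoc, inv_mul_cancel₀ hΛ0.ne', one_mul] at this
    nlinarith
  · have : Λ⁻¹ * (γ * nsq v) ≤ Λ⁻¹ * (star v ⬝ᵥ (A *ᵥ v)).re := mul_le_mul_of_nonneg_left hlo hΛi.le
    have e : 1 - γ / Λ = 1 - Λ⁻¹ * γ := by rw [div_eq_inv_mul]
    rw [e]; nlinarith

omit [Fintype ι] in
/-- reindexing along an equivalence commutes with `1 − τ•(·)`. [folklore] -/
theorem one_sub_smul_reindex {ι' : Type*} [Fintype ι'] [DecidableEq ι'] (e : ι ≃ ι') (τ : ℂ) (A : Matrix ι ι ℂ) :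
    (1 : Matrix ι' ι' ℂ) - τ • Matrix.reindex e e A = Matrix.reindex e e (1 - τ • A) := by
  ext i j
  simp [Matrix.one_apply]

/-- the entries of `(reindex A)⁻¹ − a·1` are those of `A⁻¹ − a·1` read back. [folklore] -/
theorem reindex_inv_sub_smul_one_apply {ι' : Type*} [Fintype ι'] [DecidableEq ι'] (e : ι ≃ ι') (a : ℂ) (A : Matrix ι ι ℂ) (i j : ι') :
    ((Matrix.reindex e e A)⁻¹ - a • (1 : Matrix ι' ι' ℂ)) i j = (A⁻¹ - a • (1 : Matrix ι ι ℂ)) (e.symm i) (e.symm j) := by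
  rw [Matrix.inv_reindex]
  simp [Matrix.one_apply]

end Generic

/-! ## §2 The averaged covariance read on `Tor M × Fin d`: entry formula through the (1.18) block averages -/

section Torus

variable {d : ℕ} (L : ℕ) [NeZero L] (M : Fin d → ℕ) [hM : ∀ μ, NeZero (M μ)] (a : ℝ) (ha : 0 < a)

/-- `c_k = unitCovB k` READ ON `Tor M × Fin d` IS `(L^d)^k · Q_k𝒢^{(k)}Q_kᴴ` with `Q_k = QvOp (L^k) M` the printed (1.18) averaging (`Atow_QBlev_eq_submatrix`).
[cite: Balaban1984PropagatorsI, (1.18) p.20, (1.83) p.31 (objects)] -/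
theorem reindex_unitCovB_eq (k : ℕ) :
    Matrix.reindex (unitIdx L M) (unitIdx L M) (unitCovB L M a ha k)
      = (((((L : ℝ) ^ d) ^ k : ℝ) : ℂ)) • (QvOp (lev L k) M * calG (lev L k) (one_le_lev' L k) M a ha * (QvOp (lev L k) M)ᴴ) := by
  have e : unitCovB L M a ha k
      = ((((L : ℝ) ^ d) ^ k : ℝ) : ℂ) • (Atow (QBlev L M) k * calGlev L M a ha k * (Atow (QBlev L M) k)ᴴ) := by
    unfold unitCovB avgTow; push_cast; rfl
  rw [e, Atow_QBlev_eq_submatrix]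
  ext b b'
  simp only [Matrix.reindex_apply, Matrix.submatrix_apply, Matrix.smul_apply, Matrix.mul_apply, Matrix.conjTranspose_apply,
    Equiv.apply_symm_apply, id, calGlev]

omit hM in
/-- the entries of `QvOp` are real (`0` or `n^{−(d+1)}`). [folklore] -/
theorem star_QvOp (n : ℕ) [NeZero n] (b : Tor M × Fin d) (i : Tor (fine n M) × Fin d) : star (QvOp n M b i) = QvOp n M b i := by
  unfold QvOp
  split_ifs with h
  · rw [star_sum]
    refine Finset.sum_congr rfl fun j _ => ?_
    rw [star_sum]
    refine Finset.sum_congr rfl fun t _ => ?_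
    split_ifs
    · rw [Complex.star_def, map_div₀, map_one, map_pow, map_natCast]
    · exact star_zero _
  · exact star_zero _

/-- `Σ_i Q(b,i)·f(i) = n^{−(d+1)} Σ_j Σ_t f(n·y + j + t e_μ, μ)` (`QvOp_mulVec`, read as a weighted sum). [cite: Balaban1984PropagatorsI, (1.18) p.20] -/
theorem sum_QvOp_mul (n : ℕ) [NeZero n] (b : Tor M × Fin d) (f : Tor (fine n M) × Fin d → ℂ) :
    ∑ i, QvOp n M b i * f i = 1 / (n : ℂ) ^ (d + 1) * ∑ j : Fin d → Fin n, ∑ t : Fin n, f (bpt n M b.1 j + tstep (fine n M) b.2 t, b.2) := by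
  have h := QvOp_mulVec n M f b.1 b.2
  simp only [Matrix.mulVec, dotProduct, lineSum] at h
  exact h

/-- pair-indexed form of `sum_QvOp_mul`. [folklore] -/
theorem sum_QvOp_mul_pair (n : ℕ) [NeZero n] (b : Tor M × Fin d) (f : Tor (fine n M) × Fin d → ℂ) :
    ∑ i, QvOp n M b i * f i = 1 / (n : ℂ) ^ (d + 1) * ∑ p : (Fin d → Fin n) × Fin n, f (bpt n M b.1 p.1 + tstep (fine n M) b.2 p.2, b.2) := by
  rw [sum_QvOp_mul, Fintype.sum_prod_type]

/-- `(Q G Qᴴ)((y,μ),(y′,ν)) = n^{−2(d+1)} Σ_{p,p′} G((n·y + p), (n·y′ + p′))` for ANY fine kernel `G` (pair-indexed block offsets + contour steps). [folklore] -/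
theorem QGQ_apply_pair (n : ℕ) [NeZero n] (G : Matrix (Tor (fine n M) × Fin d) (Tor (fine n M) × Fin d) ℂ) (y y' : Tor M) (μ ν : Fin d) :
    (QvOp n M * G * (QvOp n M)ᴴ) (y, μ) (y', ν) = (1 / (n : ℂ) ^ (d + 1) * (1 / (n : ℂ) ^ (d + 1))) *
      ∑ p : (Fin d → Fin n) × Fin n, ∑ p' : (Fin d → Fin n) × Fin n,
        G (bpt n M y p.1 + tstep (fine n M) μ p.2, μ) (bpt n M y' p'.1 + tstep (fine n M) ν p'.2, ν) := by
  rw [Matrix.mul_apply]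
  simp only [Matrix.conjTranspose_apply, star_QvOp, Matrix.mul_apply]
  calc ∑ i', (∑ i, QvOp n M (y, μ) i * G i i') * QvOp n M (y', ν) i'
      = ∑ i', QvOp n M (y', ν) i' * (∑ i, QvOp n M (y, μ) i * G i i') := Finset.sum_congr rfl fun i' _ => mul_comm _ _
    _ = 1 / (n : ℂ) ^ (d + 1) * ∑ p' : (Fin d → Fin n) × Fin n, ∑ i, QvOp n M (y, μ) i * G i (bpt n M y' p'.1 + tstep (fine n M) ν p'.2, ν) :=
        sum_QvOp_mul_pair M n (y', ν) (fun i' => ∑ i, QvOp n M (y, μ) i * G i i')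
    _ = 1 / (n : ℂ) ^ (d + 1) * ∑ p' : (Fin d → Fin n) × Fin n, (1 / (n : ℂ) ^ (d + 1) *
          ∑ p : (Fin d → Fin n) × Fin n, G (bpt n M y p.1 + tstep (fine n M) μ p.2, μ) (bpt n M y' p'.1 + tstep (fine n M) ν p'.2, ν)) := by
        refine congrArg (HMul.hMul _) (Finset.sum_congr rfl fun p' _ => ?_)
        exact sum_QvOp_mul_pair M n (y, μ) (fun i => G i (bpt n M y' p'.1 + tstep (fine n M) ν p'.2, ν))
    _ = (1 / (n : ℂ) ^ (d + 1) * (1 / (n : ℂ) ^ (d + 1))) * ∑ p : (Fin d → Fin n) × Fin n, ∑ p' : (Fin d → Fin n) × Fin n,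
          G (bpt n M y p.1 + tstep (fine n M) μ p.2, μ) (bpt n M y' p'.1 + tstep (fine n M) ν p'.2, ν) := by
        rw [← Finset.mul_sum, ← mul_assoc, Finset.sum_comm]

/-- nested form of `QGQ_apply_pair`: `(Q G Qᴴ)((y,μ),(y′,ν)) = n^{−2(d+1)} Σ_{j,t,j′,t′} G((n·y + j + t e_μ, μ), (n·y′ + j′ + t′e_ν, ν))`. [folklore] -/
theorem QGQ_apply (n : ℕ) [NeZero n] (G : Matrix (Tor (fine n M) × Fin d) (Tor (fine n M) × Fin d) ℂ) (y y' : Tor M) (μ ν : Fin d) :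
    (QvOp n M * G * (QvOp n M)ᴴ) (y, μ) (y', ν) = (1 / (n : ℂ) ^ (d + 1) * (1 / (n : ℂ) ^ (d + 1))) *
      ∑ j : Fin d → Fin n, ∑ t : Fin n, ∑ j' : Fin d → Fin n, ∑ t' : Fin n,
        G (bpt n M y j + tstep (fine n M) μ t, μ) (bpt n M y' j' + tstep (fine n M) ν t', ν) := by
  rw [QGQ_apply_pair]
  simp only [Fintype.sum_prod_type]

/-- **THE ENTRY FORMULA**: `c_k((y,μ),(y′,ν)) = (L^d)^k·n^{−2(d+1)}·Σ_{j,t,j′,t′} 𝒢^{(k)}((n·y + j + t e_μ, μ), (n·y′ + j′ + t′e_ν, ν))`, `n = L^k` — a FIXED finite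
combination of fine-propagator entries. [cite: Balaban1984PropagatorsI, (1.18) p.20, (1.83) p.31 (objects)] -/
theorem reindex_unitCovB_apply (k : ℕ) (y y' : Tor M) (μ ν : Fin d) :
    Matrix.reindex (unitIdx L M) (unitIdx L M) (unitCovB L M a ha k) (y, μ) (y', ν)
      = ((((L : ℝ) ^ d) ^ k : ℝ) : ℂ) * (1 / ((lev L k : ℕ) : ℂ) ^ (d + 1) * (1 / ((lev L k : ℕ) : ℂ) ^ (d + 1))) *
        ∑ j : Fin d → Fin (lev L k), ∑ t : Fin (lev L k), ∑ j' : Fin d → Fin (lev L k), ∑ t' : Fin (lev L k),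
          calG (lev L k) (one_le_lev' L k) M a ha (bpt (lev L k) M y j + tstep (fine (lev L k) M) μ t, μ)
            (bpt (lev L k) M y' j' + tstep (fine (lev L k) M) ν t', ν) := by
  rw [reindex_unitCovB_eq, Matrix.smul_apply, smul_eq_mul, QGQ_apply]
  ring

/-! ## §3 Shift invariance by unit-lattice translations (block translations of the fine torus) -/

omit hM in
/-- `up (z mod M) = (n·z) mod nM`. [folklore] -/
theorem up_castT_mul (n : ℕ) (w : Fin d → ℤ) : up n M (castT M w) = castT (fine n M) (fun μ => (n : ℤ) * w μ) := by
  funext μ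
  simp only [up, castT, upHom_intCast]
  push_cast
  ring

omit hM in
/-- unit translations are block translations of the fine torus. [folklore] -/
theorem up_mem_blockSteps (n : ℕ) (v : Tor M) : up n M v ∈ blockSteps n M := by
  rw [← castT_liftZ v, up_castT_mul]
  exact castT_blockVec_mem_blockSteps n M (liftZ v)

omit hM in
/-- `bpt (y + v) j = bpt y j + up v`. [folklore] -/
theorem bpt_add_left (n : ℕ) [NeZero n] (y v : Tor M) (j : Fin d → Fin n) : bpt n M (y + v) j = bpt n M y j + up n M v := by
  unfold bpt; rw [up_add]; abel

/-- **SHIFT INVARIANCE**: `c_k((x+v,μ),(y+v,ν)) = c_k((x,μ),(y,ν))` for every unit translation `v` (block-translation invariance of `𝒢^{(k)}`, `calG_translate`).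
[folklore] -/
theorem reindex_unitCovB_shift (k : ℕ) (x : Tor M) (μ : Fin d) (y : Tor M) (ν : Fin d) (v : Tor M) :
    Matrix.reindex (unitIdx L M) (unitIdx L M) (unitCovB L M a ha k) (x + v, μ) (y + v, ν)
      = Matrix.reindex (unitIdx L M) (unitIdx L M) (unitCovB L M a ha k) (x, μ) (y, ν) := by
  rw [reindex_unitCovB_apply, reindex_unitCovB_apply]
  refine congrArg (HMul.hMul _) ?_
  refine Finset.sum_congr rfl fun j _ => Finset.sum_congr rfl fun t _ => Finset.sum_congr rfl fun j' _ => Finset.sum_congr rfl fun t' _ => ?_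
  rw [bpt_add_left, bpt_add_left, add_right_comm (bpt (lev L k) M x j), add_right_comm (bpt (lev L k) M y j')]
  exact calG_translate (lev L k) (one_le_lev' L k) M a ha (up_mem_blockSteps M (lev L k) v) _ _ μ ν

/-! ## §4 (γ) the Neumann ratio and (α) the volume-uniform window decay of `c_k` -/

/-- **(γ) `‖1 − Cst⁻¹•c_k‖ ≤ 1 − γ_B∕Cst`**, uniformly in the torus and the level (`d ≥ 1`): `c_k` is Hermitian (`isHermitian_unitCovB`), `γ_B`-coercive (`uniformCoercive_unitCovB`) and
`‖c_k‖ ≤ Cst` (`opNorm_unitCovB_le`). [folklore] -/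
theorem opNorm_one_sub_smul_unitCovB_le (hd : 1 ≤ d) (k : ℕ) :
    ‖(1 : Matrix (Tor M × Fin d) (Tor M × Fin d) ℂ) - (((Cst d a)⁻¹ : ℝ) : ℂ) • Matrix.reindex (unitIdx L M) (unitIdx L M) (unitCovB L M a ha k)‖
      ≤ 1 - gammaB d a / Cst d a := by
  rw [one_sub_smul_reindex, opNorm_reindex]
  haveI : Nonempty (idx L M 0) := ⟨((fun _ => 0), ⟨0, hd⟩)⟩
  have hco : Coercive (gammaB d a) (unitCovB L M a ha k) := uniformCoercive_unitCovB L M a ha k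
  exact opNorm_one_sub_smul_le (isHermitian_unitCovB L M a ha k) (gammaB_pos a ha) ((le_opNorm_of_coercive hco).trans (opNorm_unitCovB_le L M a ha k))
    hco (opNorm_unitCovB_le L M a ha k)

include ha in
/-- the ratio is `< 1`. [folklore] -/
theorem one_sub_gammaB_div_Cst_lt_one : 1 - gammaB d a / Cst d a < 1 := by
  have hC : 0 < Cst d a := lt_of_lt_of_le zero_lt_one (le_max_of_le_right (le_max_right _ _))
  have := div_pos (gammaB_pos (d := d) a ha) hC
  linarith

/-- **(α) VOLUME-UNIFORM WINDOW DECAY OF `c_k` ON CUBIC TORI**: `‖c_k((w,μ),(0,ν))‖ ≤ B·e^{−κ|windowMap w|₁}` with `κ > 0`, `B ≥ 0` depending on `(d, a)` only — PART 126's `hdec` at an admissible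
rate (`exists_admissible_rate`, `conjDefect_calDalev_rho`) read through PART 134's `exp_distK_le_exp_window`. [folklore] -/
theorem exists_windowDecay_unitCovB :
    ∃ κ B : ℝ, 0 < κ ∧ 0 ≤ B ∧ ∀ (s : ℕ) [NeZero s] (k : ℕ) (μ ν : Fin d) (w : Site d s),
      ‖Matrix.reindex (unitIdx L (cubic d s)) (unitIdx L (cubic d s)) (unitCovB L (cubic d s) a ha k) (w, μ) (0, ν)‖ ≤ B * Real.exp (-(κ / d) * l1 (windowMap d s w)) := by
  obtain ⟨κ, hκ0, -, hγ', hδ', hJA⟩ := exists_admissible_rate d a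
  have hJγ : max (JA d a 1 κ 1) 0 < gamD d a := max_JA_lt_gamD a hJA
  have hBc0 : 0 ≤ (gamD d a - max (JA d a 1 κ 1) 0)⁻¹ * Real.exp (κ * 4) := by have := sub_pos.mpr hJγ; positivity
  refine ⟨κ, (gamD d a - max (JA d a 1 κ 1) 0)⁻¹ * Real.exp (κ * 4), hκ0, hBc0, fun s _ k μ ν w => ?_⟩
  have hW : ∀ (k : ℕ) (y : idx L (cubic d s) 0), WCoercive (calDalev L (cubic d s) a ha k) κ (rho L (cubic d s) k y) (gamD d a - max (JA d a 1 κ 1) 0) :=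
    fun k y => wCoercive_calDa_of_conjDefect (lev L k) (one_le_lev' L k) (cubic d s) a ha (conjDefect_calDalev_rho L (cubic d s) a ha one_pos hγ' hδ' k y)
  have hdec : EntryDecay (distK L (cubic d s)) (unitCovB L (cubic d s) a ha k) ((gamD d a - max (JA d a 1 κ 1) 0)⁻¹ * Real.exp (κ * 4)) κ :=
    hdec_unitCovB_of_wCoercive L (cubic d s) a ha hκ0.le (sub_pos.mpr hJγ) hW k
  have h := hdec ((unitIdx L (cubic d s)).symm (w, μ)) ((unitIdx L (cubic d s)).symm (0, ν))
  exact h.trans (mul_le_mul_of_nonneg_left (exp_distK_le_exp_window L s hκ0.le w μ ν) hBc0)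

/-! ## §5 (β) the volume limit of `c_k` at every `ℤ^d` offset, along the even cubic volumes (`d ≥ 3`) -/

omit hM in
/-- `up 0 = 0`. [folklore] -/
theorem up_zero (n : ℕ) : up n M 0 = 0 := by
  funext ν; simp [up]

omit hM in
/-- the fine site `n·z + j + t e_μ` of the entry formula is the reading of an integer point. [folklore] -/
theorem bpt_castT_add_tstep (n : ℕ) [NeZero n] (z : Fin d → ℤ) (j : Fin d → Fin n) (μ : Fin d) (t : Fin n) :
    bpt n M (castT M z) j + tstep (fine n M) μ t = castT (fine n M) (fun i => (n : ℤ) * z i + ((j i : ℕ) : ℤ) + if i = μ then ((t : ℕ) : ℤ) else 0) := by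
  rw [bpt, up_castT_mul]
  funext i
  simp only [Pi.add_apply, castT, iota, tstep]
  split_ifs <;> push_cast <;> ring

omit hM in
/-- the same at the origin block. [folklore] -/
theorem bpt_zero_add_tstep (n : ℕ) [NeZero n] (j : Fin d → Fin n) (μ : Fin d) (t : Fin n) :
    bpt n M 0 j + tstep (fine n M) μ t = castT (fine n M) (fun i => ((j i : ℕ) : ℤ) + if i = μ then ((t : ℕ) : ℤ) else 0) := by
  rw [bpt, up_zero, zero_add]
  funext i
  simp only [Pi.add_apply, castT, iota, tstep]
  split_ifs <;> push_cast <;> ring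

/-- **(β) THE VOLUME LIMIT OF THE AVERAGED COVARIANCE** (`d ≥ 3`): along the even cubic volumes `(ℤ∕2(t+1))^d`, every entry `c_k((ẑ,μ),(0,ν))`, `z ∈ ℤ^d`, converges — a fixed finite combination of
fine-propagator entries at integer offsets, each converging by the β-cell's `VectorPropagatorLimit.calG_tendsto_Kinf` (the limit is explicit in `K^∞`; only its existence is recorded).
[cite: Balaban1987RG1, p.264 (after (1.21): the `T ↗ ℤ^d` limit)] -/
theorem tendsto_reindex_unitCovB (hd : 3 ≤ d) (k : ℕ) (μ ν : Fin d) (z : Fin d → ℤ) :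
    ∃ c : ℂ, Tendsto (fun t => Matrix.reindex (unitIdx L (cubic d (evenPeriod t))) (unitIdx L (cubic d (evenPeriod t)))
      (unitCovB L (cubic d (evenPeriod t)) a ha k) (castT (cubic d (evenPeriod t)) z, μ) (0, ν)) atTop (𝓝 c) := by
  have hn2 : (((lev L k : ℕ) : ℂ) ^ 2) ≠ 0 := pow_ne_zero _ (by exact_mod_cast (NeZero.ne (lev L k)))
  have hterm : ∀ (j : Fin d → Fin (lev L k)) (t₁ : Fin (lev L k)) (j' : Fin d → Fin (lev L k)) (t₂ : Fin (lev L k)),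
      Tendsto (fun t => calG (lev L k) (one_le_lev' L k) (cubic d (evenPeriod t)) a ha
          (bpt (lev L k) (cubic d (evenPeriod t)) (castT (cubic d (evenPeriod t)) z) j + tstep (fine (lev L k) (cubic d (evenPeriod t))) μ t₁, μ)
          (bpt (lev L k) (cubic d (evenPeriod t)) 0 j' + tstep (fine (lev L k) (cubic d (evenPeriod t))) ν t₂, ν)) atTop
        (𝓝 ((((lev L k : ℕ) : ℂ) ^ 2)⁻¹ * ((Kinf (lev L k) a ((fun i => (lev L k : ℤ) * z i + ((j i : ℕ) : ℤ) + if i = μ then ((t₁ : ℕ) : ℤ) else 0), μ)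
            ((fun i => ((j' i : ℕ) : ℤ) + if i = ν then ((t₂ : ℕ) : ℤ) else 0), ν) : ℝ) : ℂ))) := by
    intro j t₁ j' t₂
    have h := (calG_tendsto_Kinf (lev L k) (one_le_lev' L k) a ha hd (fun i => (lev L k : ℤ) * z i + ((j i : ℕ) : ℤ) + if i = μ then ((t₁ : ℕ) : ℤ) else 0)
      (fun i => ((j' i : ℕ) : ℤ) + if i = ν then ((t₂ : ℕ) : ℤ) else 0) μ ν).const_mul ((((lev L k : ℕ) : ℂ) ^ 2)⁻¹)
    refine h.congr fun t => ?_
    rw [bpt_castT_add_tstep, bpt_zero_add_tstep, inv_mul_cancel_left₀ hn2]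
  refine ⟨_, (Tendsto.const_mul (((((L : ℝ) ^ d) ^ k : ℝ) : ℂ) * (1 / ((lev L k : ℕ) : ℂ) ^ (d + 1) * (1 / ((lev L k : ℕ) : ℂ) ^ (d + 1))))
    (tendsto_finsetSum Finset.univ fun j _ => tendsto_finsetSum Finset.univ fun t₁ _ => tendsto_finsetSum Finset.univ fun j' _ =>
      tendsto_finsetSum Finset.univ fun t₂ _ => hterm j t₁ j' t₂)).congr fun t => ?_⟩
  exact (reindex_unitCovB_apply L (cubic d (evenPeriod t)) a ha k (castT (cubic d (evenPeriod t)) z) 0 μ ν).symm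

end Torus

end Summit.QuantumFields.BalabanUV.Beta.GAN24.VolumeLimitCovariance

end
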